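import Summits.Ventures.PercRepro.S1CoreCapEightCases

/-!
# PercRepro — TOWARDS `Q*(8)`: THE HUBS OF A CHORD FAMILY (p1, gen 28)

The counting device for the last open case of the instance `ν = 8` (three big lines not in a plane): a family
`T` of 3-point lines over a base `P₁`, each with EXACTLY TWO points on `P₁` (the «bridge chords» between the plane
of two meeting big lines and the third one). Each chord has a unique point off `P₁`, its HUB `Z ∖ P₁`. Along any
list of chords every NEW hub is a free line and carries its fat into the new fat points, so the hubs are at most
the free budget (`card_hubs_add_sum_fat_le`); the chords through one hub are pairwise disjoint off it, so with an
injective «second coordinate» `Z ∩ K` into a set `K` they are at most `|K|` (`card_fibre_le`,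
`card_le_card_hubs_mul`); the cap of the family is then `|T| (1 + fat P₁) + |K| (b − #hubs)`
(`sum_cap_chords_le`). `proofs/P1-S4-CAPBRIDGE.md` §20. Axioms: standard.
-/

namespace PercRepro

namespace S1

namespace FourCap

namespace Eight

open Seven

variable {β : Type} [DecidableEq β]

section Hub

variable (w : β → ℕ) (P₁ : Finset β)

/-- A chord (three points, two on `P₁`) has exactly one point off `P₁`. -/
theorem card_sdiff_eq_one_of_chord {Z : Finset β} (hZ : Z.card = 3) (hZP : (Z ∩ P₁).card = 2) :
    (Z \ P₁).card = 1 := by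
  have := Finset.card_sdiff_add_card_inter Z P₁
  omega

omit [DecidableEq β] in
/-- Monotonicity of `fat`. -/
theorem fat_mono {S S' : Finset β} (h : S ⊆ S') : fat w S ≤ fat w S' := by
  unfold fat
  exact Finset.card_le_card (Finset.filter_subset_filter _ h)

omit [DecidableEq β] in
/-- `fat` is at most the cardinality. -/
theorem fat_le_card (S : Finset β) : fat w S ≤ S.card := by
  unfold fat
  exact Finset.card_le_card (Finset.filter_subset _ _)

/-- **Every new hub along a list of chords is a free line carrying its fat**:
`#hubs t + Σ_{n ∈ hubs t} fat n ≤ freeCountR P₁ t + fat (unionLR P₁ t ∖ P₁)`. -/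
theorem card_hubs_add_sum_fat_le_free {T : Finset (Finset β)} (hT : ∀ Z ∈ T, Z.card = 3 ∧ (Z ∩ P₁).card = 2) :
    ∀ t : List (Finset β), (∀ Z ∈ t, Z ∈ T) →
      (t.map (fun Z => Z \ P₁)).toFinset.card + ∑ n ∈ (t.map (fun Z => Z \ P₁)).toFinset, fat w n ≤
        freeCountR P₁ t + fat w (unionLR P₁ t \ P₁)
  | [], _ => by simp [freeCountR, unionLR]
  | Z :: t, hall => by
    have ih := card_hubs_add_sum_fat_le_free hT t (fun Z' hZ' => hall Z' (List.mem_cons_of_mem _ hZ'))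
    simp only [List.map_cons, List.toFinset_cons, freeCountR, unionLR]
    have hmono : fat w (unionLR P₁ t \ P₁) ≤ fat w ((Z ∪ unionLR P₁ t) \ P₁) :=
      fat_mono w (Finset.sdiff_subset_sdiff Finset.subset_union_right le_rfl)
    by_cases hmem : Z \ P₁ ∈ (t.map (fun Z => Z \ P₁)).toFinset
    · rw [Finset.insert_eq_of_mem hmem]
      split <;> omega
    · rw [Finset.card_insert_of_notMem hmem, Finset.sum_insert hmem]
      obtain ⟨hZ3, hZ2⟩ := hT Z (hall Z (by simp))
      have h1 : (Z \ P₁).card = 1 := card_sdiff_eq_one_of_chord P₁ hZ3 hZ2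
      obtain ⟨h, hh⟩ := Finset.card_eq_one.1 h1
      have hhZ : h ∈ Z \ P₁ := hh ▸ Finset.mem_singleton_self h
      have hhU : h ∉ unionLR P₁ t := by
        intro hU
        rcases mem_unionLR_iff.1 hU with hP | ⟨Z', hZ', hhZ'⟩
        · exact (Finset.mem_sdiff.1 hhZ).2 hP
        · apply hmem
          rw [List.mem_toFinset, List.mem_map]
          refine ⟨Z', hZ', ?_⟩
          obtain ⟨hZ'3, hZ'2⟩ := hT Z' (hall Z' (List.mem_cons_of_mem _ hZ'))
          obtain ⟨h', hh'⟩ := Finset.card_eq_one.1 (card_sdiff_eq_one_of_chord P₁ hZ'3 hZ'2)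
          have hmem' : h ∈ Z' \ P₁ := Finset.mem_sdiff.2 ⟨hhZ', (Finset.mem_sdiff.1 hhZ).2⟩
          rw [hh'] at hmem'
          rw [hh', ← Finset.mem_singleton.1 hmem', hh]
      have hfree : ¬ Z ⊆ unionLR P₁ t := fun hsub => hhU (hsub (Finset.mem_sdiff.1 hhZ).1)
      rw [if_neg hfree]
      have hnot : h ∉ unionLR P₁ t \ P₁ := fun hc => hhU (Finset.mem_sdiff.1 hc).1
      have hins : insert h (unionLR P₁ t \ P₁) ⊆ (Z ∪ unionLR P₁ t) \ P₁ := by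
        intro v hv
        rcases Finset.mem_insert.1 hv with rfl | hv
        · exact Finset.mem_sdiff.2 ⟨Finset.mem_union_left _ (Finset.mem_sdiff.1 hhZ).1,
            (Finset.mem_sdiff.1 hhZ).2⟩
        · exact Finset.mem_sdiff.2 ⟨Finset.mem_union_right _ (Finset.mem_sdiff.1 hv).1,
            (Finset.mem_sdiff.1 hv).2⟩
      have hfat := fat_mono w hins
      rw [fat_insert_of_notMem w hnot] at hfat
      have hfh : fat w (Z \ P₁) = if w h = 2 then 1 else 0 := by
        rw [hh]
        unfold fat
        split_ifs with h2
        · rw [Finset.filter_singleton, if_pos h2, Finset.card_singleton]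
        · rw [Finset.filter_singleton, if_neg h2, Finset.card_empty]
      rw [hfh]
      split_ifs at hfat ⊢ <;> omega

/-- **The hubs of a chord family are at most the free budget, with their fat**: under a budget `b` on free lines
and new fat points, `#hubs + Σ_{hubs} fat ≤ b`. -/
theorem card_hubs_add_sum_fat_le {T : Finset (Finset β)} (hT : ∀ Z ∈ T, Z.card = 3 ∧ (Z ∩ P₁).card = 2) {b : ℕ}
    (hk : ∀ l : List (Finset β), l.Nodup → (∀ L ∈ l, L ∈ T) →
      freeCountR P₁ l + fat w (unionLR P₁ l \ P₁) ≤ b) :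
    (T.image (fun Z => Z \ P₁)).card + ∑ n ∈ T.image (fun Z => Z \ P₁), fat w n ≤ b := by
  have h := card_hubs_add_sum_fat_le_free w P₁ hT T.toList (fun Z hZ => Finset.mem_toList.1 hZ)
  have hk' := hk T.toList (Finset.nodup_toList T) (fun Z hZ => Finset.mem_toList.1 hZ)
  have e : (T.toList.map (fun Z => Z \ P₁)).toFinset = T.image (fun Z => Z \ P₁) := by
    ext n
    simp only [List.mem_toFinset, List.mem_map, Finset.mem_toList, Finset.mem_image]
  rw [e] at h
  omega

/-- **The chords through one hub are at most the points of `K`**, when every chord meets `K` in exactly one point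
(the «second coordinate»): two chords through the hub with the same point of `K` would share two points. -/
theorem card_fibre_le {T : Finset (Finset β)} (hT : ∀ Z ∈ T, Z.card = 3 ∧ (Z ∩ P₁).card = 2)
    (hpair : ∀ Z ∈ T, ∀ Z' ∈ T, Z ≠ Z' → (Z ∩ Z').card ≤ 1) (K : Finset β) (hKP : K ⊆ P₁)
    (hK : ∀ Z ∈ T, (Z ∩ K).card = 1) (n : Finset β) :
    (T.filter (fun Z => Z \ P₁ = n)).card ≤ K.card := by
  have hmaps : ∀ Z ∈ T.filter (fun Z => Z \ P₁ = n), Z ∩ K ∈ K.powersetCard 1 := by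
    intro Z hZ
    exact Finset.mem_powersetCard.2 ⟨Finset.inter_subset_right, hK Z (Finset.mem_filter.1 hZ).1⟩
  have hinj : Set.InjOn (fun Z : Finset β => Z ∩ K) (T.filter (fun Z => Z \ P₁ = n)) := by
    intro Z hZ Z' hZ' hZZ'
    by_contra hne
    simp only at hZZ'
    have hZm := Finset.mem_filter.1 hZ
    have hZ'm := Finset.mem_filter.1 hZ'
    obtain ⟨hZ3, hZ2⟩ := hT Z hZm.1
    obtain ⟨h, hh⟩ := Finset.card_eq_one.1 (card_sdiff_eq_one_of_chord P₁ hZ3 hZ2)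
    have hhZ : h ∈ Z \ P₁ := hh ▸ Finset.mem_singleton_self h
    have hhZ' : h ∈ Z' \ P₁ := by
      rw [hZ'm.2, ← hZm.2]
      exact hhZ
    obtain ⟨y, hy⟩ := Finset.card_eq_one.1 (hK Z hZm.1)
    have hyZ : y ∈ Z ∩ K := hy ▸ Finset.mem_singleton_self y
    have hyZ' : y ∈ Z' ∩ K := hZZ' ▸ hy ▸ Finset.mem_singleton_self y
    have hhy : h ≠ y := fun e => (Finset.mem_sdiff.1 hhZ).2 (e ▸ hKP (Finset.mem_inter.1 hyZ).2)
    have hsub : ({h, y} : Finset β) ⊆ Z ∩ Z' := by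
      intro u hu
      simp only [Finset.mem_insert, Finset.mem_singleton] at hu
      rcases hu with rfl | rfl
      · exact Finset.mem_inter.2 ⟨(Finset.mem_sdiff.1 hhZ).1, (Finset.mem_sdiff.1 hhZ').1⟩
      · exact Finset.mem_inter.2 ⟨(Finset.mem_inter.1 hyZ).1, (Finset.mem_inter.1 hyZ').1⟩
    have := Finset.card_le_card hsub
    rw [Finset.card_pair hhy] at this
    have := hpair Z hZm.1 Z' hZ'm.1 hne
    omega
  have := Finset.card_le_card_of_injOn _ hmaps hinj
  rwa [Finset.card_powersetCard, Nat.choose_one_right] at this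

/-- **A chord family has at most `#hubs · |K|` members**. -/
theorem card_le_card_hubs_mul {T : Finset (Finset β)} (hT : ∀ Z ∈ T, Z.card = 3 ∧ (Z ∩ P₁).card = 2)
    (hpair : ∀ Z ∈ T, ∀ Z' ∈ T, Z ≠ Z' → (Z ∩ Z').card ≤ 1) (K : Finset β) (hKP : K ⊆ P₁)
    (hK : ∀ Z ∈ T, (Z ∩ K).card = 1) :
    T.card ≤ (T.image (fun Z => Z \ P₁)).card * K.card := by
  rw [Finset.card_eq_sum_card_image (fun Z => Z \ P₁) T]
  calc ∑ n ∈ T.image (fun Z => Z \ P₁), (T.filter (fun Z => Z \ P₁ = n)).card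
      ≤ ∑ _n ∈ T.image (fun Z => Z \ P₁), K.card :=
        Finset.sum_le_sum (fun n _ => card_fibre_le P₁ hT hpair K hKP hK n)
    _ = _ := by rw [Finset.sum_const_nat (m := K.card) (fun _ _ => rfl)]

/-- **The hub fat of a chord family**: `Σ_{Z ∈ T} fat (Z ∖ P₁) ≤ |K| · Σ_{hubs} fat`. -/
theorem sum_fat_sdiff_le {T : Finset (Finset β)} (hT : ∀ Z ∈ T, Z.card = 3 ∧ (Z ∩ P₁).card = 2)
    (hpair : ∀ Z ∈ T, ∀ Z' ∈ T, Z ≠ Z' → (Z ∩ Z').card ≤ 1) (K : Finset β) (hKP : K ⊆ P₁)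
    (hK : ∀ Z ∈ T, (Z ∩ K).card = 1) :
    ∑ Z ∈ T, fat w (Z \ P₁) ≤ K.card * ∑ n ∈ T.image (fun Z => Z \ P₁), fat w n := by
  rw [← Finset.sum_fiberwise_of_maps_to' (fun Z hZ => Finset.mem_image_of_mem (fun Z => Z \ P₁) hZ) (fat w),
    Finset.mul_sum]
  refine Finset.sum_le_sum (fun n _ => ?_)
  rw [Finset.sum_const_nat (m := fat w n) (fun _ _ => rfl)]
  exact Nat.mul_le_mul_right _ (card_fibre_le P₁ hT hpair K hKP hK n)

/-- **The cap of a chord family of the spec**: `Σ cap ≤ |T| (1 + fat P₁) + Σ_Z fat (Z ∖ P₁)`. -/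
theorem sum_cap_chords_le {T : Finset (Finset β)} (hT : ∀ Z ∈ T, Z.card = 3 ∧ (Z ∩ P₁).card = 2)
    (hw : ∀ Z ∈ T, ∀ v ∈ Z, w v = 1 ∨ w v = 2) (hw5 : ∀ Z ∈ T, wsum w Z ≤ 5) :
    ∑ Z ∈ T, capPaper Z.card (fat w Z) ≤ T.card * (1 + fat w P₁) + ∑ Z ∈ T, fat w (Z \ P₁) := by
  have hcap : ∀ Z ∈ T, capPaper Z.card (fat w Z) ≤ (1 + fat w P₁) + fat w (Z \ P₁) := by
    intro Z hZ
    have hZ3 := (hT Z hZ).1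
    have hws := wsum_eq_card_add_fat w Z (hw Z hZ)
    have h5 := hw5 Z hZ
    rw [hZ3, capPaper_three_eq' (by omega)]
    have := fat_eq_fat_sdiff_add_fat_inter w Z P₁
    have := fat_mono w (Finset.inter_subset_right : Z ∩ P₁ ⊆ P₁)
    omega
  calc ∑ Z ∈ T, capPaper Z.card (fat w Z) ≤ ∑ Z ∈ T, ((1 + fat w P₁) + fat w (Z \ P₁)) :=
        Finset.sum_le_sum hcap
    _ = _ := by rw [Finset.sum_add_distrib, Finset.sum_const_nat (m := 1 + fat w P₁) (fun _ _ => rfl)]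

end Hub

end Eight

end FourCap

end S1

end PercRepro
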